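/-
Copyright (c) 2026. All rights reserved.
Released under Apache 2.0 license as described in the file LICENSE.
Authors: abc-iut cell, cone prover seat abc-iut-w6-d028 (wave W6, block C).
-/
import Literature.AnabelianGeometry.SemiGraphs.TemperedProfiniteProducts
import Literature.AnabelianGeometry.SemiGraphs.ProfiniteCompletionModel
import Mathlib.FieldTheory.Galois.Profinite
import Mathlib.Topology.Baire.Lemmas
import Mathlib.Topology.Baire.LocallyCompactRegular
import HarnessLib

/-!
# [SemiAnbd] §6: a RANK-ONE ABELIAN inhabitant of the interface `TemperedCurve p` at which Lemma 6.1 (iii),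
# Lemma 6.3 (iii) and Theorem 6.6 FAIL — the universal closures of these typed statements over the
# interface are false (proof-only; vacuity lane)

Mochizuki, *Semi-graphs of anabelioids*, Publ. RIMS **42** (2006) [SemiAnbd], §6 pp. 69–72 (author's
ms.): Lemma 6.1 (iii) "`N_{Π_{X_K}}(Π^temp_{X_K}) = Π^temp_{X_K}`", Lemma 6.3 (iii) "for any `f ∈ F̂`
such that `f · F₁ · f⁻¹ = F₂`, it follows that `f ∈ F`", Theorem 6.6 "Every outer isomorphism
`Π_{X_K} ⥲ Π_{Y_L}` of profinite groups arises from a unique outer isomorphism `Π^temp_{X_K} ⥲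
Π^temp_{Y_L}` of tempered groups" — printed for HYPERBOLIC CURVES over finite extensions of `ℚ_p`
(proofs: [André] Cor. 6.2.2, Lemma 3.2.1, via the structure of discrete FREE groups of rank `> 1` in
their profinite completions). [cite: MochizukiSemiAnbd2006, §6 pp.69-72]

PROOF-ONLY companion (no `def`, no instance, nothing restated) of abc-iut-L3-t2's interface
`TemperedCurve p` (`TemperedAnabelian.lean`) and its typed nodes `PiTempNormallyTerminal` (Lem. 6.1
(iii)), `PiTempDenseDOFConjugator` (Lem. 6.3 (iii), `F = Π^temp`), `ProfiniteOuterIsoLifts` (Thm. 6.6).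
abc-iut-w5-d240 / abc-iut-L3-t6 inhabited the interface by the NON-compact datum `Π^temp := F₂ × G_{ℚ_p}`
(`TemperedAnabelianTowerWitnessCurve.lean`, `TemperedCurveGaloisCountableWitness.lean`) and proved that
the three statements HOLD there (rank two, free).  This file records the complementary, RANK-ONE ABELIAN
datum and proves that the three statements FAIL there:

* the datum (built inside the proofs, no definition): `K := ℚ_p`, `Π^temp := ℤ × G_{ℚ_p}` with `ℤ`
  DISCRETE (written multiplicatively), augmentation the second projection (so `Δ^temp = ℤ × 1 ≅ ℤ` —
  the interface does not exclude a non-hyperbolic geometric part), `Π := Ẑ × G_{ℚ_p}` with `toHat = η × id`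
  (`η : ℤ → Ẑ` Mathlib's profinite completion; a profinite completion in the sense of the interface by
  abc-iut-w5-d218's `IsProfiniteCompletion.prodMap_id` / `isProfiniteCompletion_toProfiniteCompletion`,
  injective since `ℤ` is residually finite), NO closed points;
* `exists_temperedCurve_rankOne_failures` — at this `X`: (a) `Π^temp ↪ Π` is NOT onto (Baire: a compact
  Hausdorff group is not a countably infinite union of points), (b) the image of `Π^temp` is NORMAL in
  `Π` (`η(ℤ)` is central in `Ẑ`: centralisers are closed and `η` has dense range), hence
  (c) `¬ X.PiTempNormallyTerminal` (`N_Π(Π^temp) = Π ≠ Π^temp`), (d) `¬ X.PiTempDenseDOFConjugator`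
  (`F₁ = F₂ = Π^temp` is of DOF-type and dense, and any `f ∈ Π ∖ Π^temp` conjugates it to itself), and
  (e) `¬ X'.ProfiniteOuterIsoLifts X` for the profinite twin `X'` (`Π^temp := Π := Ẑ × G_{ℚ_p}`, same
  `Π`): the identity of `Π` has no tempered lift `Ẑ × G_{ℚ_p} ≃ₜ* ℤ × G_{ℚ_p}` (compact vs. non-compact);
* the universal closures over the interface are therefore FALSE: `not_forall_piTempNormallyTerminal`,
  `not_forall_piTempDenseDOFConjugator`, `not_forall_profiniteOuterIsoLifts`.

HONEST FRAMING: a junk inhabitant refutes a universal closure over the INTERFACE, not the printed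
theorems, which concern hyperbolic curves (free `Δ^temp` of rank `> 1`); it is evidence that these typed
nodes must be consumed at a certified origin (`TemperedOrigin`, abc-iut-L3), exactly as designed.  Classical
topological group theory only (Ribes–Zalesskii §3.2; Baire); nothing of [SemiAnbd] is asserted; no side is
taken on [IUTchIII] Cor. 3.12; typed ≠ proved.
-/

noncomputable section

namespace Literature.AnabelianGeometry.SemiGraphs

open CategoryTheory ProfiniteGrp ProfiniteGrp.ProfiniteCompletion
open _root_.Topology
open scoped Pointwise

universe u v

/-! ### Two classical bricks on dense-range homomorphisms into compact groups -/

section Bricks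

variable {F : Type u} {Fh : Type v} [Group F] [TopologicalSpace F] [Group Fh] [TopologicalSpace Fh]
  [IsTopologicalGroup Fh] [T2Space Fh]

/-- If `F` is commutative and `ι : F → F̂` has dense range in a Hausdorff topological group, then every
`ι f` is CENTRAL in `F̂` (the centraliser of `ι f` is closed and contains the dense subgroup `ι(F)`).
[cite: MochizukiSemiAnbd2006, §6 p.69] -/
theorem central_of_denseRange_of_comm (ι : F →ₜ* Fh) (hd : DenseRange ι)
    (hcomm : ∀ a b : F, a * b = b * a) (f : F) (x : Fh) : x * ι f = ι f * x := by
  have hS : IsClosed {y : Fh | y * ι f = ι f * y} :=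
    isClosed_eq (continuous_id.mul continuous_const) (continuous_const.mul continuous_id)
  have hsub : Set.range (ι : F → Fh) ⊆ {y : Fh | y * ι f = ι f * y} := by
    rintro _ ⟨g, rfl⟩
    show ι g * ι f = ι f * ι g
    rw [← map_mul, hcomm, map_mul]
  have hx : x ∈ closure (Set.range (ι : F → Fh)) := by
    rw [hd.closure_range]; trivial
  exact hS.closure_subset_iff.2 hsub hx

/-- An INJECTIVE homomorphism from a countably infinite group into a compact Hausdorff group is never
onto: otherwise the compact group is a countable union of points, one of which is open by Baire, so the
group is discrete, hence finite. [cite: MochizukiSemiAnbd2006, §6 p.69] -/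
theorem not_surjective_of_injective_of_compactSpace [Countable F] [Infinite F] [CompactSpace Fh]
    (ι : F →ₜ* Fh) (hinj : Function.Injective ι) : ¬ Function.Surjective ι := by
  intro hsurj
  haveI : Nonempty Fh := ⟨1⟩
  obtain ⟨n, hn⟩ := nonempty_interior_of_iUnion_of_closed (X := Fh)
    (f := fun n : F => ({ι n} : Set Fh)) (fun _ => isClosed_singleton)
    (Set.eq_univ_of_forall fun y => by
      obtain ⟨n, rfl⟩ := hsurj y
      exact Set.mem_iUnion.2 ⟨n, rfl⟩)
  have hopen : IsOpen ({ι n} : Set Fh) := by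
    have hint : interior ({ι n} : Set Fh) = {ι n} :=
      Set.Subset.antisymm interior_subset (fun z hz => by
        obtain ⟨y, hy⟩ := hn
        rw [Set.mem_singleton_iff.1 hz]
        exact Set.mem_singleton_iff.1 (interior_subset hy) ▸ hy)
    rw [← hint]
    exact isOpen_interior
  have hone : IsOpen ({1} : Set Fh) := by
    have h := (Homeomorph.mulLeft (ι n)⁻¹).isOpenMap _ hopen
    rw [Set.image_singleton] at h
    simpa using h
  haveI : DiscreteTopology Fh := discreteTopology_of_isOpen_singleton_one hone
  haveI : Finite Fh := finite_of_compact_of_discrete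
  haveI : Finite F := Finite.of_injective _ hinj
  exact not_finite F

end Bricks

/-! ### The rank-one datum and the three failures -/

section Curve

variable (p : ℕ) [Fact p.Prime]

/-- `ℤ` (written multiplicatively) is residually finite: `m ≠ 0` survives in `ℤ/(|m|+1)` (local copy of a
classical one-liner; the tree's `Literature.IUT.HodgeTheaters.residuallyFinite_multiplicative_int` lives
in a module this file does not import). [cite: MochizukiSemiAnbd2006, §6 p.69] -/
private theorem residuallyFinite_multiplicativeInt : Group.ResiduallyFinite (Multiplicative ℤ) := by
  refine Group.residuallyFinite_of_forall_exists_finite_monoidHom fun x hx => ?_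
  let m : ℤ := Multiplicative.toAdd x
  let N : ℕ := m.natAbs + 1
  haveI : NeZero N := ⟨Nat.succ_ne_zero _⟩
  refine ⟨Multiplicative (ZMod N), inferInstance, inferInstance,
    AddMonoidHom.toMultiplicative (Int.castAddHom (ZMod N)), fun h => hx ?_⟩
  have h1 : ((m : ℤ) : ZMod N) = 0 := congrArg Multiplicative.toAdd h
  rw [ZMod.intCast_zmod_eq_zero_iff_dvd] at h1
  have hm0 : m = 0 := by
    by_contra h0
    have := Nat.le_of_dvd (Int.natAbs_pos.mpr h0) (Int.natCast_dvd.mp h1)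
    omega
  exact Multiplicative.toAdd.injective hm0

/-- **The rank-one abelian inhabitant of `TemperedCurve p` and its three failures.** There is
`X : TemperedCurve p` (`K = ℚ_p`, `Π^temp := ℤ × G_{ℚ_p}` with `ℤ` discrete, `Π := Ẑ × G_{ℚ_p}`, no closed
points) such that: `Π^temp` is not compact while `Π` is; `Π^temp → Π` is not onto; its image is a normal
subgroup of `Π`; Lemma 6.1 (iii) `PiTempNormallyTerminal` FAILS; Lemma 6.3 (iii) `PiTempDenseDOFConjugator`
FAILS; and Theorem 6.6 `ProfiniteOuterIsoLifts X' X` FAILS for some `X'` (the profinite twin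
`Π^temp := Π`) with the same profinite completion. [cite: MochizukiSemiAnbd2006, §6 pp.69-72] -/
theorem exists_temperedCurve_rankOne_failures :
    ∃ X : TemperedCurve p,
      ¬ CompactSpace X.PiTemp ∧ CompactSpace X.PiHat ∧
      ¬ Function.Surjective X.toHat ∧ X.toHat.toMonoidHom.range.Normal ∧
      ¬ X.PiTempNormallyTerminal ∧ ¬ X.PiTempDenseDOFConjugator ∧
      ∃ X' : TemperedCurve p, X'.PiHat = X.PiHat ∧ ¬ X'.ProfiniteOuterIsoLifts X := by
  haveI : IsGalois ℚ_[p] (AlgebraicClosure ℚ_[p]) := {}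
  haveI : T2Space (GQp p) := krullTopology_t2
  haveI := residuallyFinite_multiplicativeInt
  haveI : Countable (Multiplicative ℤ) := inferInstanceAs (Countable ℤ)
  haveI : Infinite (Multiplicative ℤ) := inferInstanceAs (Infinite ℤ)
  -- `η : ℤ → Ẑ`, a profinite completion in the sense of the interface, injective
  let η : Multiplicative ℤ →ₜ* completion (GrpCat.of (Multiplicative ℤ)) :=
    { toMonoidHom := toProfiniteCompletion (Multiplicative ℤ)
      continuous_toFun := continuous_of_discreteTopology }
  have hη : IsProfiniteCompletion η := isProfiniteCompletion_toProfiniteCompletion (Multiplicative ℤ)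
  have hηinj : Function.Injective η := toProfiniteCompletion_injective
  haveI : CompactSpace (completion (GrpCat.of (Multiplicative ℤ))) := hη.compactSpace
  -- the rank-one datum
  let X : TemperedCurve p :=
    { K := ⊥
      finiteDimensional_K := inferInstance
      PiTemp := Multiplicative ℤ × GQp p
      aug := ContinuousMonoidHom.snd (Multiplicative ℤ) (GQp p)
      range_aug := by
        rw [IntermediateField.fixingSubgroup_bot]
        exact MonoidHom.range_eq_top.mpr Prod.snd_surjective
      PiHat := completion (GrpCat.of (Multiplicative ℤ)) × GQp p
      toHat := η.prodMap (ContinuousMonoidHom.id (GQp p))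
      isProfiniteCompletion_toHat := hη.prodMap_id
      toHat_injective := hηinj.prodMap Function.injective_id
      augHat := ContinuousMonoidHom.snd _ (GQp p)
      augHat_comp := fun _ => rfl
      Pt := PEmpty
      IsCusp := fun x => x.elim
      decomp := fun x => x.elim
      isClosed_decomp := fun x => x.elim
      isOpen_aug_decomp := fun x => x.elim
      inertia_eq_bot := fun x => x.elim
      inertia_equiv_zHat := fun x => x.elim }
  -- the profinite twin: `Π^temp := Π`, `toHat := id`
  let X' : TemperedCurve p :=
    { K := ⊥
      finiteDimensional_K := inferInstance
      PiTemp := completion (GrpCat.of (Multiplicative ℤ)) × GQp p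
      aug := ContinuousMonoidHom.snd _ (GQp p)
      range_aug := by
        rw [IntermediateField.fixingSubgroup_bot]
        exact MonoidHom.range_eq_top.mpr Prod.snd_surjective
      PiHat := completion (GrpCat.of (Multiplicative ℤ)) × GQp p
      toHat := ContinuousMonoidHom.id _
      isProfiniteCompletion_toHat :=
        { compactSpace := inferInstance
          t2Space := inferInstance
          totallyDisconnectedSpace := inferInstance
          denseRange := denseRange_id
          comap_surjective := fun U _ => ⟨U, by ext; rfl⟩
          isOpen_comap := fun V => V.isOpen' }
      toHat_injective := Function.injective_id
      augHat := ContinuousMonoidHom.snd _ (GQp p)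
      augHat_comp := fun _ => rfl
      Pt := PEmpty
      IsCusp := fun x => x.elim
      decomp := fun x => x.elim
      isClosed_decomp := fun x => x.elim
      isOpen_aug_decomp := fun x => x.elim
      inertia_eq_bot := fun x => x.elim
      inertia_equiv_zHat := fun x => x.elim }
  -- (0) `Π^temp = ℤ × G_{ℚ_p}` is not compact (its discrete quotient `ℤ` would be finite)
  have hnc : ¬ CompactSpace (Multiplicative ℤ × GQp p) := by
    intro hc
    have hK : IsCompact (Set.univ : Set (Multiplicative ℤ)) := by
      rw [← Set.image_univ_of_surjective (Prod.fst_surjective (β := GQp p))]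
      exact isCompact_univ.image continuous_fst
    haveI : CompactSpace (Multiplicative ℤ) := ⟨hK⟩
    haveI : Finite (Multiplicative ℤ) := finite_of_compact_of_discrete
    exact not_finite (Multiplicative ℤ)
  -- (a) `toHat = η × id` is not onto, since `η` is not
  have hηns : ¬ Function.Surjective η := not_surjective_of_injective_of_compactSpace η hηinj
  have hns : ¬ Function.Surjective X.toHat := by
    intro hs
    apply hηns
    intro z
    obtain ⟨⟨n, g⟩, hng⟩ := hs (z, 1)
    exact ⟨n, (Prod.mk.inj hng).1⟩
  -- (b) the image of `Π^temp` is normal in `Π`: `η(ℤ)` is central in `Ẑ`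
  have hcentral : ∀ (n : Multiplicative ℤ) (a : completion (GrpCat.of (Multiplicative ℤ))),
      a * η n = η n * a :=
    fun n a => central_of_denseRange_of_comm η hη.denseRange (fun a b => mul_comm a b) n a
  have hnormal : X.toHat.toMonoidHom.range.Normal := by
    refine ⟨?_⟩
    rintro _ ⟨⟨n, g⟩, rfl⟩ ⟨a, c⟩
    refine ⟨⟨n, c * g * c⁻¹⟩, ?_⟩
    show ((η n, c * g * c⁻¹) : completion (GrpCat.of (Multiplicative ℤ)) × GQp p) =
      (a, c) * (η n, g) * (a, c)⁻¹
    rw [Prod.inv_mk, Prod.mk_mul_mk, Prod.mk_mul_mk, hcentral n a, mul_inv_cancel_right]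
  -- (c) Lemma 6.1 (iii) fails: the normalizer is everything, the image is not
  have hrange_ne_top : X.toHat.toMonoidHom.range ≠ ⊤ := fun h =>
    hns (MonoidHom.range_eq_top.1 h)
  have hNT : ¬ X.PiTempNormallyTerminal := by
    intro h
    change Subgroup.normalizer (X.toHat.toMonoidHom.range : Set X.PiHat) = X.toHat.toMonoidHom.range at h
    rw [Subgroup.normalizer_eq_top_iff.2 hnormal] at h
    exact hrange_ne_top h.symm
  -- (d) Lemma 6.3 (iii) fails: `F₁ = F₂ = Π^temp`, conjugator outside the image
  have hDOF : IsDOFType (⊤ : Subgroup X.PiTemp) :=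
    ⟨⊤, isOpen_univ, inferInstance, by rw [Subgroup.coe_top, closure_univ]⟩
  have hdense : Dense (X.toHat '' ((⊤ : Subgroup X.PiTemp) : Set X.PiTemp)) := by
    rw [Subgroup.coe_top, Set.image_univ]
    exact X.isProfiniteCompletion_toHat.denseRange
  have hDC : ¬ X.PiTempDenseDOFConjugator := by
    intro h
    obtain ⟨c, hc'⟩ := not_forall.1 hns
    have hc : c ∉ X.toHat.toMonoidHom.range := fun hmem => hc' (MonoidHom.mem_range.1 hmem)
    have hconj : ConjAct.toConjAct c • (⊤ : Subgroup X.PiTemp).map X.toHat.toMonoidHom =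
        (⊤ : Subgroup X.PiTemp).map X.toHat.toMonoidHom := by
      rw [← MonoidHom.range_eq_map]
      exact hnormal.conjAct _
    exact hc (by simpa using h ⊤ ⊤ hDOF hDOF hdense hdense (ConjAct.toConjAct c) hconj)
  -- (e) Theorem 6.6 fails for the pair `(X', X)`: no tempered lift of the identity of `Π`
  have hOut : ¬ X'.ProfiniteOuterIsoLifts X := by
    intro h
    obtain ⟨⟨β, -⟩, -⟩ := h (ContinuousMulEquiv.refl _)
    haveI : CompactSpace X'.PiTemp :=
      inferInstanceAs (CompactSpace (completion (GrpCat.of (Multiplicative ℤ)) × GQp p))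
    exact hnc β.toHomeomorph.compactSpace
  exact ⟨X, hnc, inferInstanceAs (CompactSpace (completion (GrpCat.of (Multiplicative ℤ)) × GQp p)),
    hns, hnormal, hNT, hDC, X', rfl, hOut⟩

/-- **The universal closure of [SemiAnbd] Lemma 6.1 (iii) over the interface `TemperedCurve p` is
FALSE**: some inhabitant has `N_Π(Π^temp) ≠ Π^temp`. [cite: MochizukiSemiAnbd2006, Lem 6.1(iii) p.69] -/
theorem not_forall_piTempNormallyTerminal : ¬ ∀ X : TemperedCurve p, X.PiTempNormallyTerminal := by
  obtain ⟨X, -, -, -, -, hX, -⟩ := exists_temperedCurve_rankOne_failures p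
  exact fun h => hX (h X)

/-- **The universal closure of [SemiAnbd] Lemma 6.3 (iii) (`F = Π^temp`) over the interface is FALSE.**
[cite: MochizukiSemiAnbd2006, Lem 6.3(iii) p.70] -/
theorem not_forall_piTempDenseDOFConjugator :
    ¬ ∀ X : TemperedCurve p, X.PiTempDenseDOFConjugator := by
  obtain ⟨X, -, -, -, -, -, hX, -⟩ := exists_temperedCurve_rankOne_failures p
  exact fun h => hX (h X)

/-- **The universal closure of [SemiAnbd] Theorem 6.6 over pairs of inhabitants of the interface is
FALSE.** [cite: MochizukiSemiAnbd2006, Thm 6.6 p.72] -/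
theorem not_forall_profiniteOuterIsoLifts :
    ¬ ∀ X Y : TemperedCurve p, X.ProfiniteOuterIsoLifts Y := by
  obtain ⟨X, -, -, -, -, -, -, X', -, hX'⟩ := exists_temperedCurve_rankOne_failures p
  exact fun h => hX' (h X' X)

end Curve

end Literature.AnabelianGeometry.SemiGraphs

end
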